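import Mathlib.Algebra.Order.Field.Basic
import Mathlib.Algebra.Order.Ring.Rat
import Mathlib.Tactic.Linarith
import Mathlib.Tactic.NormNum
import Mathlib.Tactic.Positivity
import Mathlib.Tactic.FieldSimp
import HarnessLib

/-!
# The H-AXIS CENSUS of the material-oracle acceptance test (ACCEPTANCE v1.4 §4.4b, hubbard-eph RULING R-19) as a
# total function, with the theorem that says WHY it is informational: widening a field box can only improve its
# verdict

Venture CertifiedManyBodySolver, cell `pub/hubbard-downfold`, seat hubbard-downfold-score-1 (second scoring
engine); namespace `Summit.Ventures.CertifiedManyBodySolver.Downfold.CellScore`. D-0099/D-0100 name the field axis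
of the phase map (T × P × H); ACCEPTANCE v1.4 R27 types it as an ANNEX `H-box-T` {interval [lo, hi] tesla, h_type,
model} on the (T = 0, P, H = 0) cell and compares it, for information only, with the curators' critical-field figures.
Everything here is PROVED (linear / elementary field arithmetic over `ℚ`).

WHAT THIS IS NOT: not a statement about any material's critical field, not a field model, not a clause of the
acceptance test (§4.4b verbatim: «it ranks boxes, it never passes or fails anything»). This is the KERNEL REFERENCE for
the verdict both scorers (`deputy-2/score.py` v1.4 96d8d6a1, `validation/score/phasemap.py` 1.4.0) print, and it makes
precise the sentence that keeps the census OUT of §7.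

* §1 THE VERDICT (§4.4b verbatim: «consistent (annex interval ∩ truth hull ≠ ∅) · near ×r (disjoint; gap ratio
  r = truth_lo / annex_hi or annex_lo / truth_hi ≤ 4 [v1.4-proposed INFORMATIONAL window]) · inconsistent (r > 4)»):
  `hVerdict lo hi tlo thi` for an annex box `[lo, hi]` against the truth hull `[tlo, thi]` (both engines' branch:
  meet ⇒ consistent; else, with both upper figures positive, r = tlo/hi if the box lies below the hull, lo/thi if
  above; r ≤ 4 ⇒ near, else — or with a zero upper figure — inconsistent); `rank` orders inconsistent < near <
  consistent; the column BINDING predicate `binds Pe P` («|P_e − P| ≤ max(10 GPa, 10 % of the entry's P)»).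
* §2 THEOREMS. (a) `hVerdict_eq_consistent_iff`: consistent ⇔ the two closed intervals share a point (well-formed
  box and hull). (b) THE WIDENING THEOREM `rank_le_rank_of_widen`: replacing the box by any SUPERSET `[lo', hi'] ⊇
  [lo, hi]` never lowers the verdict — consistent stays consistent, near becomes near or consistent. Hence
  (c) THE SAYS-NOTHING THEOREM OF THE FIELD AXIS `hVerdict_zero_lo_of_le`: a box `[0, B]` with `B ≥ tlo` is
  «consistent» against every hull — which is exactly why §4.4b credits nothing: a verdict that a wide enough box
  always earns cannot be evidence for the field model (the H-axis twin of «a [0, 300] K band hits everything and says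
  nothing», `PhaseMapBandClasses.credit_zero_lo_eq_false`). (d) `hVerdict_smul`: the verdict is scale-free (tesla
  or gauss, r is a ratio). (e) `binds` facts: an entry at 155 GPa binds the 150 GPa column and not the 200 GPa one
  (the H₃S exemplar of the text); at 100 GPa the reach is exactly 10 GPa.
* §3 the numbers of §4.4b / deputy-2's selftest S17 evaluated: H₃S box [60.2, 112.3] T vs hull [73, 97] consistent;
  [30, 40] near (r = 2.2); [5, 12] inconsistent (r = 7.3); [400, 500] inconsistent (r = 4.12, just outside the
  window); the widened [30, 80] of the near box is consistent and [0, 500] is consistent against anything below 500 T.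

Design: `ℚ`; the verdict omits the engines' bookkeeping labels (no-truth / type-mismatch / quantity-mismatch /
malformed / «(untyped)»), which select WHICH figures are compared, not how.
-/

namespace Summit.Ventures.CertifiedManyBodySolver.Downfold

namespace CellScore

/-! ## §1 Verdict, rank, binding -/

/-- The three comparable verdicts of the §4.4b census. [folklore] -/
inductive HVerdict
  /-- the annex interval meets the truth hull -/
  | consistent
  /-- disjoint, gap ratio ≤ 4 (printed «near ×r») -/
  | near
  /-- disjoint, gap ratio > 4 (or a zero upper figure) -/
  | inconsistent
  deriving DecidableEq, Repr

/-- ACCEPTANCE §4.4b verdict of an annex box `[lo, hi]` (tesla) against the truth hull `[tlo, thi]` — both engines'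
branch, window ×4 [v1.4-proposed, informational]. [folklore] -/
def hVerdict (lo hi tlo thi : ℚ) : HVerdict :=
  if tlo ≤ hi ∧ lo ≤ thi then .consistent
  else if 0 < hi ∧ 0 < thi ∧ (if hi < tlo then tlo / hi else lo / thi) ≤ 4 then .near
  else .inconsistent

/-- inconsistent < near < consistent, as a number. [folklore] -/
def HVerdict.rank : HVerdict → ℕ
  | .inconsistent => 0
  | .near => 1
  | .consistent => 2

/-- §4.4b / §2.3 BINDING of a truth entry quoted at pressure `Pe` to a map column at `P`:
«within max(10 GPa, 10 % of the entry's P_GPa)». [folklore] -/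
def binds (Pe P : ℚ) : Bool := decide (|Pe - P| ≤ max 10 (Pe / 10))

/-! ## §2 Property sheet -/

section verdict

variable {lo hi tlo thi lo' hi' : ℚ}

/-- consistent ⇔ `tlo ≤ hi ∧ lo ≤ thi`. [folklore] -/
theorem hVerdict_eq_consistent_iff' : hVerdict lo hi tlo thi = .consistent ↔ tlo ≤ hi ∧ lo ≤ thi := by
  unfold hVerdict
  split_ifs with h1 h2 <;> simp [h1]

/-- (a) consistent ⇔ the closed box and the closed hull share a point (well-formed box `lo ≤ hi` and hull
`tlo ≤ thi`). [folklore] -/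
theorem hVerdict_eq_consistent_iff (hb : lo ≤ hi) (ht : tlo ≤ thi) :
    hVerdict lo hi tlo thi = .consistent ↔ ∃ x, lo ≤ x ∧ x ≤ hi ∧ tlo ≤ x ∧ x ≤ thi := by
  rw [hVerdict_eq_consistent_iff']
  constructor
  · rintro ⟨h1, h2⟩
    exact ⟨max lo tlo, le_max_left _ _, max_le hb h1, le_max_right _ _, max_le h2 ht⟩
  · rintro ⟨x, h1, h2, h3, h4⟩
    exact ⟨h3.trans h2, h1.trans h4⟩

/-- A disjoint pair is near or inconsistent, never consistent. [folklore] -/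
theorem hVerdict_ne_consistent_of_disjoint (h : hi < tlo ∨ thi < lo) : hVerdict lo hi tlo thi ≠ .consistent := by
  rw [Ne, hVerdict_eq_consistent_iff']
  rintro ⟨h1, h2⟩
  rcases h with h | h <;> linarith

/-- `near` unfolded: disjoint, both upper figures positive, gap ratio ≤ 4. [folklore] -/
theorem hVerdict_eq_near_iff : hVerdict lo hi tlo thi = .near ↔
    ¬ (tlo ≤ hi ∧ lo ≤ thi) ∧ 0 < hi ∧ 0 < thi ∧ (if hi < tlo then tlo / hi else lo / thi) ≤ 4 := by
  unfold hVerdict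
  split_ifs with h1 h2 <;> simp_all

/-- (b) THE WIDENING THEOREM: a SUPERSET box `[lo', hi'] ⊇ [lo, hi]` never reads worse (well-formed box and hull).
Consistent stays consistent; a near box below the hull gets r' = tlo/hi' ≤ tlo/hi, one above gets r' = lo'/thi ≤ lo/thi,
unless widening already made it meet the hull. [folklore] -/
theorem rank_le_rank_of_widen (hb : lo ≤ hi) (ht : tlo ≤ thi) (hlo : lo' ≤ lo) (hhi : hi ≤ hi') :
    (hVerdict lo hi tlo thi).rank ≤ (hVerdict lo' hi' tlo thi).rank := by
  by_cases hc' : tlo ≤ hi' ∧ lo' ≤ thi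
  · -- the widened box meets the hull: top rank
    rw [hVerdict_eq_consistent_iff'.mpr hc']
    cases hVerdict lo hi tlo thi <;> decide
  · -- the widened box is still disjoint, hence so was the original
    have hc : ¬ (tlo ≤ hi ∧ lo ≤ thi) := fun h => hc' ⟨h.1.trans hhi, hlo.trans h.2⟩
    by_cases hn : hVerdict lo hi tlo thi = .near
    · obtain ⟨-, hpos, htpos, hr⟩ := hVerdict_eq_near_iff.mp hn
      have hpos' : 0 < hi' := lt_of_lt_of_le hpos hhi
      have hn' : hVerdict lo' hi' tlo thi = .near := by
        refine hVerdict_eq_near_iff.mpr ⟨hc', hpos', htpos, ?_⟩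
        by_cases hlt : hi < tlo
        · -- original below the hull ⇒ widened below the hull too (else it would meet it)
          have hlt' : hi' < tlo := by
            by_contra hge
            exact hc' ⟨not_lt.mp hge, by linarith⟩
          rw [if_pos hlt] at hr
          rw [if_pos hlt', div_le_iff₀ hpos']
          have := (div_le_iff₀ hpos).mp hr
          nlinarith
        · -- original above the hull (thi < lo) ⇒ widened is above too
          have habove : thi < lo := by
            by_contra hge
            exact hc ⟨not_lt.mp hlt, not_lt.mp hge⟩
          have hlt' : ¬ hi' < tlo := fun h => hlt (lt_of_le_of_lt hhi h)
          rw [if_neg hlt] at hr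
          rw [if_neg hlt', div_le_iff₀ htpos]
          have := (div_le_iff₀ htpos).mp hr
          linarith
      rw [hn, hn']
    · -- original inconsistent: rank 0
      have h0 : hVerdict lo hi tlo thi = .inconsistent := by
        have hnc : hVerdict lo hi tlo thi ≠ .consistent := fun h => hc (hVerdict_eq_consistent_iff'.mp h)
        revert hn hnc
        cases hVerdict lo hi tlo thi <;> simp
      rw [h0]
      exact Nat.zero_le _

/-- (c) THE SAYS-NOTHING THEOREM OF THE FIELD AXIS: the box `[0, B]` is «consistent» against every hull whose lower
figure it reaches (`tlo ≤ B`, `0 ≤ thi`) — so «consistent» cannot be credited. [folklore] -/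
theorem hVerdict_zero_lo_of_le {B : ℚ} (hB : tlo ≤ B) (hthi : 0 ≤ thi) : hVerdict 0 B tlo thi = .consistent :=
  hVerdict_eq_consistent_iff'.mpr ⟨hB, hthi⟩

/-- … in particular widening ANY box down to 0 and up to the truth's lower figure makes it consistent (for a
non-negative hull). [folklore] -/
theorem hVerdict_widen_to_zero (ht : tlo ≤ thi) (htlo : 0 ≤ tlo) :
    hVerdict 0 (max hi tlo) tlo thi = .consistent :=
  hVerdict_zero_lo_of_le (le_max_right _ _) (htlo.trans ht)

/-- (d) SCALE-FREENESS: a common positive rescaling (tesla ↦ gauss) changes no verdict. [folklore] -/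
theorem hVerdict_smul {c : ℚ} (hc : 0 < c) (lo hi tlo thi : ℚ) :
    hVerdict (c * lo) (c * hi) (c * tlo) (c * thi) = hVerdict lo hi tlo thi := by
  have hle : ∀ x y : ℚ, c * x ≤ c * y ↔ x ≤ y := fun x y => by
    constructor
    · intro h; nlinarith
    · intro h; nlinarith
  have hlt : ∀ x y : ℚ, c * x < c * y ↔ x < y := fun x y => by
    constructor
    · intro h; nlinarith
    · intro h; nlinarith
  have hpos : ∀ x : ℚ, 0 < c * x ↔ 0 < x := fun x => by
    constructor
    · intro h; nlinarith
    · intro h; positivity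
  have hdiv : ∀ x y : ℚ, c * x / (c * y) = x / y := fun x y => mul_div_mul_left x y hc.ne'
  unfold hVerdict
  simp only [hle, hlt, hpos, hdiv]

end verdict

section binding

/-- `binds` unfolded. [folklore] -/
theorem binds_iff {Pe P : ℚ} : binds Pe P = true ↔ |Pe - P| ≤ max 10 (Pe / 10) := by simp [binds]

/-- Binding is reflexive (an entry judges its own pressure). [folklore] -/
theorem binds_self (Pe : ℚ) : binds Pe Pe = true := by
  rw [binds_iff, sub_self, abs_zero]
  exact le_trans (by norm_num) (le_max_left _ _)

end binding

/-! ## §3 The §4.4b numbers (H₃S exemplar: truth hull [73, 97] T from entries at 155 / 160 GPa) -/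

section cases

/-- hubbard-eph's clean-limit orbital box [60.2, 112.3] T vs [73, 97] T: consistent («a ×1.9-wide box straddles the
measurement — printed, not credited»). [folklore] -/
example : hVerdict (602 / 10) (1123 / 10) 73 97 = .consistent := by norm_num [hVerdict]

/-- [30, 40] T: disjoint below, r = 73/40 ≤ 4 ⇒ near (deputy-2 S17c prints «near x2.2» against 88/40 with the
single-entry hull). [folklore] -/
example : hVerdict 30 40 73 97 = .near ∧ hVerdict 30 40 88 97 = .near := by norm_num [hVerdict]

/-- [5, 12] T: r = 88/12 ≈ 7.3 > 4 ⇒ inconsistent (S17d). [folklore] -/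
example : hVerdict 5 12 88 97 = .inconsistent := by norm_num [hVerdict]

/-- [400, 500] T above the hull: r = 400/97 ≈ 4.12 > 4 ⇒ inconsistent — just outside the window; [380, 500] (r 3.9)
is near. [folklore] -/
example : hVerdict 400 500 88 97 = .inconsistent ∧ hVerdict 380 500 88 97 = .near := by norm_num [hVerdict]

/-- the widening theorem in numbers: the near box [30, 40] widened to [30, 80] is consistent; the says-nothing box
[0, 500] is consistent. [folklore] -/
example : hVerdict 30 80 73 97 = .consistent ∧ hVerdict 0 500 73 97 = .consistent := by norm_num [hVerdict]

/-- a zero upper figure is never «near» (no ratio): [0, 0] vs [73, 97] inconsistent. [folklore] -/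
example : hVerdict 0 0 73 97 = .inconsistent := by norm_num [hVerdict]

/-- BINDING of the text: an entry at 155 GPa binds the 150 GPa column (|Δ| = 5 ≤ 15.5) and not the 200 GPa one
(45 > 15.5); at 100 GPa the reach is exactly 10 GPa (111 is out, 110 is in). [folklore] -/
example : binds 155 150 = true ∧ binds 155 200 = false ∧ binds 100 111 = false ∧ binds 100 110 = true := by
  norm_num [binds, abs_of_nonneg, abs_of_nonpos, max_def]

end cases

end CellScore

end Summit.Ventures.CertifiedManyBodySolver.Downfold
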